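import Summits.CriticalPhenomena.PercolationContinuityZ3.Theorems.FK.LatticeEdgeCounting
import HarnessLib

/-!
# FK-continuity cell, FO-10a (pressure layer): the mean density of open edges of the free / wired box measures
# converges to `d · h⁰(p,q)` / `d · h¹(p,q)` — Grimmett 2006, (4.75)–(4.76), sharpened to a limit

Registered R84 (cell INBOX l.6112, 2026-08-24); registry row FO-10a-g338d; label PRS-F (coordinator fk-4 g187).
Cell `fk-continuity` (bschramm), row FO-10a (domain-Markov + comparison layer over FO-06); support file for the
FK-continuity transplant (`--supports stmt-CriticalPhenomena-4575`); builds on p205010 (kernel theorem, internal audit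
signed; external expert review pending). Pure proofs; no definitions, no named facts, no sorries; general `d`.
UNCONDITIONAL finite- and infinite-volume structure; it decides nothing about FH / TP_FK / the value of `p_c(q)`.

The `π`-derivative of the finite-volume pressure is the mean number of open edges per site (Grimmett 2006, (4.72)–(4.73));
Grimmett's (4.75) bounds it by the infinite-volume edge densities `h^b(p,q) = φ^b_{p,q}(J_e)`. Here the sharp form needed for the
identification of the one-sided derivatives of the pressure (Grimmett's (4.76)–(4.77)): for `q ≥ 1`, `0 ≤ p ≤ 1`, a lattice edge
`e₀` and the boxes `Λ_N = [-N,N]^d`,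

  `|Λ_N|⁻¹ E^b_{Λ_N,p,q} |ω| = |Λ_N|⁻¹ ∑_{e ∈ E_{Λ_N}} φ^b_{Λ_N,p,q}(J_e) → d · h^b(p,q)`   (`b = 0` free, `b = 1` wired),

with `h⁰ = freeEdgeDensity d p q e₀`, `h¹ = wiredEdgeDensity d p q e₀` (Literature `RandomClusterShiftedBoxes.lean`), by the
box-monotonicity sandwich (`φ⁰_{Λ_N}(J_e) ≤ h⁰`, `φ¹_{Λ_N}(J_e) ≥ h¹`, and for the edges `⟨x, x+eᵢ⟩` with `x ∈ Λ_{N-m}` the reverse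
bounds by the densities of the translated box `x + Λ_m`, Literature `boxFreeEdgeProb_sub_siteRad_le_map_add` /
`boxWiredEdgeProb_map_add_le_sub_siteRad`), the count `d |Λ_{N-m}| ≤ |E_{Λ_N}| ≤ d |Λ_N|` of `LatticeEdgeCounting.lean`, and an
`ε`-free order argument (`tendsto_order`: for `b < d h⁰` pick `m` with `∑ᵢ φ⁰_{Λ_m}(J_{⟨0,eᵢ⟩}) > b`):

* `sum_boxFreeEdgeProb_le`, `le_sum_boxFreeEdgeProb`, `le_sum_boxWiredEdgeProb`, `sum_boxWiredEdgeProb_le` — the sandwiches;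
* `coordEdge_zero_mem_edgeSet`, `sum_freeEdgeDensity_coordEdge_eq`, `sum_wiredEdgeDensity_coordEdge_eq` (`∑ᵢ h^b(⟨0,eᵢ⟩) = d h^b(e₀)`);
* **`tendsto_sum_boxFreeEdgeProb_div_card_box`**, **`tendsto_sum_boxWiredEdgeProb_div_card_box`**,
  **`tendsto_rcExpect_card_div_card_box_false`**, **`tendsto_rcExpect_card_div_card_box_true`** (`|Λ_N|⁻¹ E^b_{Λ_N}|ω| → d h^b`).

Honest framing: infinite-volume averaging; no statement about `p_c(q)`; NOT a binder discharge, NOT `_r4`.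

## References

* G. Grimmett, *The Random-Cluster Model*, Springer 2006 (`book:grimmett2006-random-cluster-model`): §4.5, (4.61), proof of
  Thm. (4.63), (4.72)–(4.77) [PDF pp. 89–93]; Thm. (4.19)(a) with (4.24) (box monotonicity). [Grimmett2006]
-/

noncomputable section

open Finset Filter Topology

namespace Summit.CriticalPhenomena.PercolationContinuityZ3.Theorems.FK

open Literature.Probability.Percolation Literature.Probability.LatticeModels

variable {d : ℕ}

/-! ### The sandwiches -/

section Sandwich

variable {p q : ℝ}

/-- Upper bound, free: `∑_{e ∈ E_{Λ_N}} φ⁰_{Λ_N}(J_e) ≤ d |Λ_N| h⁰` (`φ⁰_{Λ_N}(J_e) ≤ h⁰(e) = h⁰(e₀)` for every edge).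
[cite: Grimmett2006, proof of Thm. (4.63), (4.75)] -/
theorem sum_boxFreeEdgeProb_le (hp : p ∈ Set.Icc (0 : ℝ) 1) (hq : 1 ≤ q) {e₀ : Sym2 (Site d)}
    (he₀ : e₀ ∈ (zdGraph d).edgeSet) (N : ℕ) :
    ∑ e ∈ edgesIn (zdGraph d) (box d N), boxFreeEdgeProb d p q e N ≤ d * #(box d N) * freeEdgeDensity d p q e₀ := by
  have hq0 : 0 < q := one_pos.trans_le hq
  have hh : 0 ≤ freeEdgeDensity d p q e₀ := by
    obtain ⟨i, x, rfl⟩ := exists_eq_map_add_of_mem_edgeSet he₀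
    exact (freeEdgeProb_nonneg _ _ _ _).trans (boxFreeEdgeProb_le_freeEdgeDensity hp hq0 (N := pairRad _) le_rfl)
  calc ∑ e ∈ edgesIn (zdGraph d) (box d N), boxFreeEdgeProb d p q e N
      ≤ ∑ e ∈ edgesIn (zdGraph d) (box d N), freeEdgeDensity d p q e₀ := by
        refine Finset.sum_le_sum fun e he => ?_
        rw [mem_edgesIn_iff] at he
        rw [← freeEdgeDensity_eq_of_mem_edgeSet hp hq he.1 he₀]
        exact boxFreeEdgeProb_le_freeEdgeDensity hp hq0 (pairRad_le_of_forall_mem_box he.2)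
    _ = #(edgesIn (zdGraph d) (box d N)) * freeEdgeDensity d p q e₀ := by rw [Finset.sum_const, nsmul_eq_mul]
    _ ≤ d * #(box d N) * freeEdgeDensity d p q e₀ := by
        refine mul_le_mul_of_nonneg_right ?_ hh
        exact_mod_cast card_edgesIn_le_mul_card (box d N)

/-- Lower bound, free, by the deep edges: for `1 ≤ m ≤ N`,
`|Λ_{N-m}| ∑ᵢ φ⁰_{Λ_m}(J_{⟨0,eᵢ⟩}) ≤ ∑_{e ∈ E_{Λ_N}} φ⁰_{Λ_N}(J_e)` (`φ⁰_{Λ_N}(J_{⟨x,x+eᵢ⟩}) ≥ φ⁰_{x + Λ_m}(J_{⟨x,x+eᵢ⟩}) = φ⁰_{Λ_m}(J_{⟨0,eᵢ⟩})`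
for `x ∈ Λ_{N-m}`, by box monotonicity and translation invariance). [cite: Grimmett2006, Thm. (4.19)(a) with (4.24), and (4.75)] -/
theorem le_sum_boxFreeEdgeProb (hp : p ∈ Set.Icc (0 : ℝ) 1) (hq : 1 ≤ q) {N m : ℕ} (hm : 1 ≤ m) (hmN : m ≤ N) :
    (#(box d (N - m)) : ℝ) * ∑ i : Fin d, boxFreeEdgeProb d p q s((0 : Site d), Pi.single i 1) m ≤
      ∑ e ∈ edgesIn (zdGraph d) (box d N), boxFreeEdgeProb d p q e N := by
  classical
  set ι : Site d × Fin d → Sym2 (Site d) := fun xi => s(xi.1, xi.1 + Pi.single xi.2 1) with hι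
  have hsub : (box d (N - m) ×ˢ (Finset.univ : Finset (Fin d))).image ι ⊆ edgesIn (zdGraph d) (box d N) := by
    intro e he
    rw [Finset.mem_image] at he
    obtain ⟨⟨x, i⟩, hxi, rfl⟩ := he
    exact coordEdge_mem_edgesIn_box hm hmN (Finset.mem_product.1 hxi).1 i
  calc (#(box d (N - m)) : ℝ) * ∑ i : Fin d, boxFreeEdgeProb d p q s((0 : Site d), Pi.single i 1) m
      = ∑ x ∈ box d (N - m), ∑ i : Fin d, boxFreeEdgeProb d p q s((0 : Site d), Pi.single i 1) m := by
        rw [Finset.sum_const, nsmul_eq_mul]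
    _ ≤ ∑ x ∈ box d (N - m), ∑ i : Fin d, boxFreeEdgeProb d p q (ι (x, i)) N := by
        refine Finset.sum_le_sum fun x hx => Finset.sum_le_sum fun i _ => ?_
        have hxr : siteRad x ≤ N - m := mem_box_iff_siteRad_le.1 hx
        have h1 : pairRad s((0 : Site d), Pi.single i 1) + siteRad x ≤ N := by rw [pairRad_coordEdge_zero]; omega
        calc boxFreeEdgeProb d p q s((0 : Site d), Pi.single i 1) m
            ≤ boxFreeEdgeProb d p q s((0 : Site d), Pi.single i 1) (N - siteRad x) :=
              boxFreeEdgeProb_mono hp hq (by rw [pairRad_coordEdge_zero]; exact hm) (by omega)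
          _ ≤ boxFreeEdgeProb d p q (Sym2.map (· + x) s((0 : Site d), Pi.single i 1)) N :=
              boxFreeEdgeProb_sub_siteRad_le_map_add x hp hq h1
          _ = boxFreeEdgeProb d p q (ι (x, i)) N := by simp only [hι, coordEdge_eq_map_add]
    _ = ∑ xi ∈ box d (N - m) ×ˢ (Finset.univ : Finset (Fin d)), boxFreeEdgeProb d p q (ι xi) N := by
        rw [Finset.sum_product]
    _ = ∑ e ∈ (box d (N - m) ×ˢ (Finset.univ : Finset (Fin d))).image ι, boxFreeEdgeProb d p q e N := by
        rw [Finset.sum_image fun a _ b _ h => coordEdge_injective h]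
    _ ≤ ∑ e ∈ edgesIn (zdGraph d) (box d N), boxFreeEdgeProb d p q e N :=
        Finset.sum_le_sum_of_subset_of_nonneg hsub fun e _ _ => freeEdgeProb_nonneg _ _ _ _

/-- Lower bound, wired: `|E_{Λ_N}| h¹ ≤ ∑_{e ∈ E_{Λ_N}} φ¹_{Λ_N}(J_e)`, hence `d |Λ_{N-1}| h¹ ≤ …` for `N ≥ 1`.
[cite: Grimmett2006, proof of Thm. (4.63), (4.75)] -/
theorem le_sum_boxWiredEdgeProb (hd : 0 < d) (hp : p ∈ Set.Icc (0 : ℝ) 1) (hq : 1 ≤ q) {e₀ : Sym2 (Site d)}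
    (he₀ : e₀ ∈ (zdGraph d).edgeSet) {N : ℕ} (hN : 1 ≤ N) :
    d * #(box d (N - 1)) * wiredEdgeDensity d p q e₀ ≤ ∑ e ∈ edgesIn (zdGraph d) (box d N), boxWiredEdgeProb d p q e N := by
  have hh : 0 ≤ wiredEdgeDensity d p q e₀ :=
    le_ciInf fun n => wiredEdgeProb_nonneg _ _ _ _
  calc (d : ℝ) * #(box d (N - 1)) * wiredEdgeDensity d p q e₀
      ≤ #(edgesIn (zdGraph d) (box d N)) * wiredEdgeDensity d p q e₀ := by
        refine mul_le_mul_of_nonneg_right ?_ hh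
        exact_mod_cast card_box_mul_le_card_edgesIn_box (d := d) le_rfl hN
    _ = ∑ e ∈ edgesIn (zdGraph d) (box d N), wiredEdgeDensity d p q e₀ := by rw [Finset.sum_const, nsmul_eq_mul]
    _ ≤ ∑ e ∈ edgesIn (zdGraph d) (box d N), boxWiredEdgeProb d p q e N := by
        refine Finset.sum_le_sum fun e he => ?_
        rw [mem_edgesIn_iff] at he
        rw [← wiredEdgeDensity_eq_of_mem_edgeSet hd hp hq he.1 he₀]
        exact wiredEdgeDensity_le_boxWiredEdgeProb (pairRad_le_of_forall_mem_box he.2)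

/-- Upper bound, wired, by the deep edges: for `1 ≤ m ≤ N`,
`∑_{e ∈ E_{Λ_N}} φ¹_{Λ_N}(J_e) ≤ |Λ_{N-m}| ∑ᵢ φ¹_{Λ_m}(J_{⟨0,eᵢ⟩}) + d(|Λ_N| - |Λ_{N-m}|)` (deep edges by box monotonicity and translation
invariance, the others by `1`). [cite: Grimmett2006, Thm. (4.19)(a) with (4.24), and (4.75)] -/
theorem sum_boxWiredEdgeProb_le (hd : 0 < d) (hp : p ∈ Set.Icc (0 : ℝ) 1) (hq : 1 ≤ q) {N m : ℕ} (hm : 1 ≤ m)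
    (hmN : m ≤ N) :
    ∑ e ∈ edgesIn (zdGraph d) (box d N), boxWiredEdgeProb d p q e N ≤
      (#(box d (N - m)) : ℝ) * ∑ i : Fin d, boxWiredEdgeProb d p q s((0 : Site d), Pi.single i 1) m +
        d * ((#(box d N) : ℝ) - #(box d (N - m))) := by
  classical
  have hq0 : 0 < q := one_pos.trans_le hq
  set ι : Site d × Fin d → Sym2 (Site d) := fun xi => s(xi.1, xi.1 + Pi.single xi.2 1) with hι
  set T := (box d (N - m) ×ˢ (Finset.univ : Finset (Fin d))).image ι with hT
  have hsub : T ⊆ edgesIn (zdGraph d) (box d N) := by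
    intro e he
    rw [hT, Finset.mem_image] at he
    obtain ⟨⟨x, i⟩, hxi, rfl⟩ := he
    exact coordEdge_mem_edgesIn_box hm hmN (Finset.mem_product.1 hxi).1 i
  have hcardT : #T = d * #(box d (N - m)) := by
    rw [hT, Finset.card_image_of_injective _ coordEdge_injective, Finset.card_product, Finset.card_univ,
      Fintype.card_fin, mul_comm]
  -- split the sum into the deep edges `T` and the rest
  rw [← Finset.sum_sdiff hsub]
  have hrest : ∑ e ∈ edgesIn (zdGraph d) (box d N) \ T, boxWiredEdgeProb d p q e N ≤
      d * ((#(box d N) : ℝ) - #(box d (N - m))) := by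
    calc ∑ e ∈ edgesIn (zdGraph d) (box d N) \ T, boxWiredEdgeProb d p q e N
        ≤ ∑ e ∈ edgesIn (zdGraph d) (box d N) \ T, (1 : ℝ) :=
          Finset.sum_le_sum fun e _ => wiredEdgeProb_le_one _ hp hq0 _
      _ = #(edgesIn (zdGraph d) (box d N) \ T) := by rw [Finset.sum_const, nsmul_eq_mul, mul_one]
      _ ≤ d * ((#(box d N) : ℝ) - #(box d (N - m))) := by
          rw [Finset.card_sdiff_of_subset hsub, Nat.cast_sub (Finset.card_le_card hsub), hcardT, mul_sub]
          push_cast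
          have := card_edgesIn_le_mul_card (d := d) (box d N)
          have h' : (#(edgesIn (zdGraph d) (box d N)) : ℝ) ≤ d * #(box d N) := by exact_mod_cast this
          linarith
  have hdeep : ∑ e ∈ T, boxWiredEdgeProb d p q e N ≤
      (#(box d (N - m)) : ℝ) * ∑ i : Fin d, boxWiredEdgeProb d p q s((0 : Site d), Pi.single i 1) m := by
    rw [hT, Finset.sum_image fun a _ b _ h => coordEdge_injective h, Finset.sum_product]
    calc ∑ x ∈ box d (N - m), ∑ i : Fin d, boxWiredEdgeProb d p q (ι (x, i)) N
        ≤ ∑ x ∈ box d (N - m), ∑ i : Fin d, boxWiredEdgeProb d p q s((0 : Site d), Pi.single i 1) m :=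
          Finset.sum_le_sum fun x hx => Finset.sum_le_sum fun i _ => ?_
      _ = _ := by rw [Finset.sum_const, nsmul_eq_mul]
    have hxr : siteRad x ≤ N - m := mem_box_iff_siteRad_le.1 hx
    have h1 : pairRad s((0 : Site d), Pi.single i 1) + siteRad x ≤ N := by rw [pairRad_coordEdge_zero]; omega
    calc boxWiredEdgeProb d p q (ι (x, i)) N
        = boxWiredEdgeProb d p q (Sym2.map (· + x) s((0 : Site d), Pi.single i 1)) N := by simp only [hι, coordEdge_eq_map_add]
      _ ≤ boxWiredEdgeProb d p q s((0 : Site d), Pi.single i 1) (N - siteRad x) :=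
          boxWiredEdgeProb_map_add_le_sub_siteRad hd x hp hq h1
      _ ≤ boxWiredEdgeProb d p q s((0 : Site d), Pi.single i 1) m :=
          boxWiredEdgeProb_anti hd hp hq (by rw [pairRad_coordEdge_zero]; exact hm) (by omega)
  linarith

end Sandwich

/-! ### The limits -/

section Limit

variable {p q : ℝ}

/-- The sum of the limiting free densities over the `d` coordinate edges at the origin is `d h⁰(e₀)`. [cite: Grimmett2006, (4.61)] -/
theorem sum_freeEdgeDensity_coordEdge_eq (hp : p ∈ Set.Icc (0 : ℝ) 1) (hq : 1 ≤ q) {e₀ : Sym2 (Site d)}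
    (he₀ : e₀ ∈ (zdGraph d).edgeSet) :
    ∑ i : Fin d, freeEdgeDensity d p q s((0 : Site d), Pi.single i 1) = d * freeEdgeDensity d p q e₀ := by
  rw [Finset.sum_congr rfl fun i _ => freeEdgeDensity_eq_of_mem_edgeSet hp hq (coordEdge_zero_mem_edgeSet i) he₀,
    Finset.sum_const, Finset.card_univ, Fintype.card_fin, nsmul_eq_mul]

/-- The sum of the limiting wired densities over the `d` coordinate edges at the origin is `d h¹(e₀)`. [cite: Grimmett2006, (4.61)] -/
theorem sum_wiredEdgeDensity_coordEdge_eq (hd : 0 < d) (hp : p ∈ Set.Icc (0 : ℝ) 1) (hq : 1 ≤ q) {e₀ : Sym2 (Site d)}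
    (he₀ : e₀ ∈ (zdGraph d).edgeSet) :
    ∑ i : Fin d, wiredEdgeDensity d p q s((0 : Site d), Pi.single i 1) = d * wiredEdgeDensity d p q e₀ := by
  rw [Finset.sum_congr rfl fun i _ => wiredEdgeDensity_eq_of_mem_edgeSet hd hp hq (coordEdge_zero_mem_edgeSet i) he₀,
    Finset.sum_const, Finset.card_univ, Fintype.card_fin, nsmul_eq_mul]

/-- **The mean density of open edges of the FREE box measure converges to `d h⁰(p,q)`**:
`|Λ_N|⁻¹ ∑_{e ∈ E_{Λ_N}} φ⁰_{Λ_N,p,q}(J_e) → d · h⁰(p,q)(e₀)` (`q ≥ 1`, `0 ≤ p ≤ 1`, any lattice edge `e₀`).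
[cite: Grimmett2006, proof of Thm. (4.63), (4.75)–(4.76)] -/
theorem tendsto_sum_boxFreeEdgeProb_div_card_box (hp : p ∈ Set.Icc (0 : ℝ) 1) (hq : 1 ≤ q) {e₀ : Sym2 (Site d)}
    (he₀ : e₀ ∈ (zdGraph d).edgeSet) :
    Tendsto (fun N : ℕ => (∑ e ∈ edgesIn (zdGraph d) (box d N), boxFreeEdgeProb d p q e N) / #(box d N)) atTop
      (𝓝 (d * freeEdgeDensity d p q e₀)) := by
  set c : ℕ → ℝ := fun m => ∑ i : Fin d, boxFreeEdgeProb d p q s((0 : Site d), Pi.single i 1) m with hc_def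
  have hc : Tendsto c atTop (𝓝 (d * freeEdgeDensity d p q e₀)) := by
    rw [← sum_freeEdgeDensity_coordEdge_eq hp hq he₀]
    exact tendsto_finsetSum _ fun i _ => tendsto_boxFreeEdgeProb hp hq _
  rw [tendsto_order]
  constructor
  · intro b hb
    obtain ⟨m, hm1, hbm⟩ : ∃ m, 1 ≤ m ∧ b < c m :=
      ((eventually_ge_atTop 1).and (hc.eventually (lt_mem_nhds hb))).exists
    have hr := (tendsto_card_box_sub_div_card_box (d := d) m).mul_const (c m)
    rw [one_mul] at hr
    filter_upwards [hr.eventually (lt_mem_nhds hbm), eventually_ge_atTop m] with N hN hNm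
    refine hN.trans_le ?_
    rw [div_mul_eq_mul_div, div_le_div_iff_of_pos_right (by exact_mod_cast Finset.card_pos.2 (box_nonempty d N))]
    exact le_sum_boxFreeEdgeProb hp hq hm1 hNm
  · intro b hb
    filter_upwards with N
    refine lt_of_le_of_lt ?_ hb
    rw [div_le_iff₀ (by exact_mod_cast Finset.card_pos.2 (box_nonempty d N))]
    calc ∑ e ∈ edgesIn (zdGraph d) (box d N), boxFreeEdgeProb d p q e N
        ≤ d * #(box d N) * freeEdgeDensity d p q e₀ := sum_boxFreeEdgeProb_le hp hq he₀ N
      _ = d * freeEdgeDensity d p q e₀ * #(box d N) := by ring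

/-- **The mean density of open edges of the WIRED box measure converges to `d h¹(p,q)`**:
`|Λ_N|⁻¹ ∑_{e ∈ E_{Λ_N}} φ¹_{Λ_N,p,q}(J_e) → d · h¹(p,q)(e₀)` (`q ≥ 1`, `0 ≤ p ≤ 1`, any lattice edge `e₀`).
[cite: Grimmett2006, proof of Thm. (4.63), (4.75)–(4.76)] -/
theorem tendsto_sum_boxWiredEdgeProb_div_card_box (hp : p ∈ Set.Icc (0 : ℝ) 1) (hq : 1 ≤ q) {e₀ : Sym2 (Site d)}
    (he₀ : e₀ ∈ (zdGraph d).edgeSet) :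
    Tendsto (fun N : ℕ => (∑ e ∈ edgesIn (zdGraph d) (box d N), boxWiredEdgeProb d p q e N) / #(box d N)) atTop
      (𝓝 (d * wiredEdgeDensity d p q e₀)) := by
  obtain ⟨i₀, -, -⟩ := exists_eq_map_add_of_mem_edgeSet he₀
  have hd : 0 < d := i₀.pos
  set c : ℕ → ℝ := fun m => ∑ i : Fin d, boxWiredEdgeProb d p q s((0 : Site d), Pi.single i 1) m with hc_def
  have hc : Tendsto c atTop (𝓝 (d * wiredEdgeDensity d p q e₀)) := by
    rw [← sum_wiredEdgeDensity_coordEdge_eq hd hp hq he₀]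
    exact tendsto_finsetSum _ fun i _ => tendsto_boxWiredEdgeProb hd hp hq _
  rw [tendsto_order]
  constructor
  · intro b hb
    have hl : Tendsto (fun N : ℕ => (d : ℝ) * ((#(box d (N - 1)) : ℝ) / #(box d N)) * wiredEdgeDensity d p q e₀) atTop
        (𝓝 (d * wiredEdgeDensity d p q e₀)) := by
      have h := ((tendsto_card_box_sub_div_card_box (d := d) 1).const_mul (d : ℝ)).mul_const (wiredEdgeDensity d p q e₀)
      rwa [mul_one] at h
    filter_upwards [hl.eventually (lt_mem_nhds hb), eventually_ge_atTop 1] with N hN hN1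
    refine hN.trans_le ?_
    rw [mul_div_assoc', div_mul_eq_mul_div, div_le_div_iff_of_pos_right (by exact_mod_cast Finset.card_pos.2 (box_nonempty d N))]
    exact le_sum_boxWiredEdgeProb hd hp hq he₀ hN1
  · intro b hb
    obtain ⟨m, hm1, hbm⟩ : ∃ m, 1 ≤ m ∧ c m < b :=
      ((eventually_ge_atTop 1).and (hc.eventually (gt_mem_nhds hb))).exists
    have hu : Tendsto (fun N : ℕ => ((#(box d (N - m)) : ℝ) / #(box d N)) * c m +
        d * (1 - (#(box d (N - m)) : ℝ) / #(box d N))) atTop (𝓝 (c m)) := by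
      have h1 := tendsto_card_box_sub_div_card_box (d := d) m
      have h := (h1.mul_const (c m)).add (((tendsto_const_nhds (x := (1 : ℝ))).sub h1).const_mul (d : ℝ))
      rwa [one_mul, sub_self, mul_zero, add_zero] at h
    filter_upwards [hu.eventually (gt_mem_nhds hbm), eventually_ge_atTop m] with N hN hNm
    refine lt_of_le_of_lt ?_ hN
    have hpos : (0 : ℝ) < #(box d N) := by exact_mod_cast Finset.card_pos.2 (box_nonempty d N)
    rw [div_le_iff₀ hpos]
    calc ∑ e ∈ edgesIn (zdGraph d) (box d N), boxWiredEdgeProb d p q e N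
        ≤ (#(box d (N - m)) : ℝ) * c m + d * ((#(box d N) : ℝ) - #(box d (N - m))) :=
          sum_boxWiredEdgeProb_le hd hp hq hm1 hNm
      _ = (((#(box d (N - m)) : ℝ) / #(box d N)) * c m + d * (1 - (#(box d (N - m)) : ℝ) / #(box d N))) * #(box d N) := by
          field_simp

/-- **`|Λ_N|⁻¹ E⁰_{Λ_N,p,q}|ω| → d · h⁰(p,q)`**: the mean number of open edges per site of the free box measure
`φ⁰_{Λ_N,p,q} = rcBoxMeasure d false p q N` (Grimmett's `|E_Λ|⁻¹ φ⁰_Λ(|η|)`, (4.75), which tends to `h⁰`).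
[cite: Grimmett2006, proof of Thm. (4.63), (4.73)–(4.76)] -/
theorem tendsto_rcExpect_card_div_card_box_false (hp : p ∈ Set.Icc (0 : ℝ) 1) (hq : 1 ≤ q) {e₀ : Sym2 (Site d)}
    (he₀ : e₀ ∈ (zdGraph d).edgeSet) :
    Tendsto (fun N : ℕ => rcExpect (finsetGraph (zdGraph d) (box d N)) p q (boxBC d false N) (fun ω => (#ω : ℝ)) /
      #(box d N)) atTop (𝓝 (d * freeEdgeDensity d p q e₀)) := by
  have hq0 : 0 < q := one_pos.trans_le hq
  refine (tendsto_sum_boxFreeEdgeProb_div_card_box hp hq he₀).congr fun N => ?_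
  rw [rcExpect_card_eq_sum_edgesIn hp hq0]
  rfl

/-- **`|Λ_N|⁻¹ E¹_{Λ_N,p,q}|ω| → d · h¹(p,q)`**: the mean number of open edges per site of the wired box measure
`φ¹_{Λ_N,p,q} = rcBoxMeasure d true p q N` (Grimmett's `|E_Λ|⁻¹ φ¹_Λ(|η|)`, (4.75), which tends to `h¹`).
[cite: Grimmett2006, proof of Thm. (4.63), (4.73)–(4.76)] -/
theorem tendsto_rcExpect_card_div_card_box_true (hp : p ∈ Set.Icc (0 : ℝ) 1) (hq : 1 ≤ q) {e₀ : Sym2 (Site d)}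
    (he₀ : e₀ ∈ (zdGraph d).edgeSet) :
    Tendsto (fun N : ℕ => rcExpect (finsetGraph (zdGraph d) (box d N)) p q (boxBC d true N) (fun ω => (#ω : ℝ)) /
      #(box d N)) atTop (𝓝 (d * wiredEdgeDensity d p q e₀)) := by
  have hq0 : 0 < q := one_pos.trans_le hq
  refine (tendsto_sum_boxWiredEdgeProb_div_card_box hp hq he₀).congr fun N => ?_
  rw [rcExpect_card_eq_sum_edgesIn hp hq0]
  rfl

end Limit

end Summit.CriticalPhenomena.PercolationContinuityZ3.Theorems.FK
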